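import Summits.HodgeConjecture.CorCM.TransversalAvoidingTranslate
import HarnessLib

/-!
# Fibre types over a normal subgroup with a complement containing `c`: the two-fibre and transversal certificates
# (internal form — the totally real factor `M` need not be Galois)

COR-CM (cell `pub-hodgecm2`), binder seat b04 (gen 24), count-neutral claim REAL-FACTOR, part IV (blanket
`CorCM/GaloisRealFactor*`, HOME/INBOX l.10153).  Pure group theory (Mathlib + gen 19 part I); KERNEL ONLY: theorems;
no definition, no named fact, no `sorry`.  `HC_CM` is neither used nor claimed.

SETTING.  A finite group `G` with a central involution `c`, a NORMAL subgroup `N ⊴ G` and a subgroup `Γ' ≤ G` with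
`N ∩ Γ' = 1`, `N Γ' = G` and `c ∈ Γ'` — i.e. `G = N ⋊ Γ'` with `c` in the complement (acting trivially on `N`).  For a
Galois CM field `K` with `G = Gal(K/ℚ)`: `N = Gal(K/L)` for a Galois CM subfield `L` (group `Γ' ≅ Gal(L/ℚ)`) and
`Γ' = Gal(K/M)` for a TOTALLY REAL subfield `M` with `K = M·L`, `[K:ℚ] = [M:ℚ][L:ℚ]` — `M` need NOT be Galois
(parts II–III are the case `Γ' ⊴ G`, `G = N × Γ'`).  `F ⊆ Γ'` is a primitive CM set of `(Γ', c)`.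

For `A ⊆ N` the FIBRE TYPE `T_A = A·F ∪ (N ∖ A)·cF` (`q γ ∈ T_A ↔ (q ∈ A ↔ γ ∈ F)`, `q ∈ N`, `γ ∈ Γ'`) is a CM
set for `c` (§2).  Since `(a b)(q γ) = (a · b q b⁻¹)(b γ)`, a period `a b` of `T_A` with `b = 1` gives `aA = A`,
with `b = c` gives `aA = N ∖ A`, and any other `b` makes `b` or `c b` a period of `F` (fibre over `q = 1`) — exactly
as in the direct-product case (gen 23 XII, part II), the action of `Γ'` on `N` never enters (§3).  Two certificates
in gen 20's format (CM set with trivial left stabiliser + balanced finite set moved by `c`):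

* §4 **two-fibre** (`exists_certificate_twoFibre`): `A` an ADMISSIBLE HALF of `N` (part I), balanced set `D = N`;
* §5 **transversal** (`exists_certificate_transversal`): `V ≤ N`, `3 ≤ |V|`, a non-involution `y₀ ∈ N ∖ V`,
  `A = ` gen 19's right transversal of `V` in `N` with trivial left stabiliser, balanced set `D = V ∪ V y₀ c`.

Part V (`CorCM/GaloisRealFactorComplement`) reads them on `Gal(K/ℚ)` and assembles the theorem «`Gal(K/L) ∉
{1, C₂, C₂², C₂³, C₄, C_p, S₃}` ⟹ BAD» for every Galois CM subfield `L` with a primitive type and a totally real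
complement.  Numerical check `scratch/g24c.py` (`C₃² ⋊ C₄`, `Dic₉ = C₉ ⋊ C₄`, `C₁₅ ⋊ C₄`, `A₄ ⋊ C₄`, `C₃² ⋊ Q₈`,
`D₅ ⋊ C₄`, `C₂⁴ ⋊ C₄`: CM, primitive, balanced, moved, Kubota rank `< |G|/2 + 1` — 0 failures).

## References

* [Shimura1998] G. Shimura, *Abelian Varieties with Complex Multiplication and Modular Functions*, §8.2 Prop. 26.
* [Dodson1984] B. Dodson, *The structure of Galois groups of CM-fields*, Trans. AMS 283 (1984), §3.1.1.
-/

namespace Summit.HodgeConjecture.CorCM.Complement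

open Summit.HodgeConjecture.CorCM.TwiceOdd (exists_transversal card_mul_card_eq)

variable {G : Type*} [Group G] [Fintype G] [DecidableEq G] {N Γ' : Subgroup G} {c : G} {F A T : Finset G}

/-! ## §1 Unique factorisation `g = q γ` -/

omit [Fintype G] [DecidableEq G] in
/-- `N ∩ Γ' = 1` makes the factorisation `q γ` (`q ∈ N`, `γ ∈ Γ'`) unique. [folklore] -/
theorem eq_of_mul_eq_mul (hdisj : ∀ g, g ∈ N → g ∈ Γ' → g = 1) {q q' γ γ' : G} (hq : q ∈ N) (hq' : q' ∈ N)
    (hγ : γ ∈ Γ') (hγ' : γ' ∈ Γ') (h : q * γ = q' * γ') : q = q' ∧ γ = γ' := by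
  have h1 : q'⁻¹ * q = γ' * γ⁻¹ := by
    rw [inv_mul_eq_iff_eq_mul, ← mul_assoc, eq_mul_inv_iff_mul_eq, h]
  have hN : q'⁻¹ * q ∈ N := N.mul_mem (N.inv_mem hq') hq
  have hΓ : q'⁻¹ * q ∈ Γ' := by rw [h1]; exact Γ'.mul_mem hγ' (Γ'.inv_mem hγ)
  have h2 := hdisj _ hN hΓ
  refine ⟨?_, ?_⟩
  · rw [inv_mul_eq_one] at h2; exact h2.symm
  · rw [h2] at h1; exact (mul_inv_eq_one.1 h1.symm).symm

/-- **The fibre type over `A`** exists as a finset: `q γ ∈ T ↔ (q ∈ A ↔ γ ∈ F)` for `q ∈ N`, `γ ∈ Γ'`. [folklore] -/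
theorem exists_fibreType (hdisj : ∀ g, g ∈ N → g ∈ Γ' → g = 1) (A F : Finset G) :
    ∃ T : Finset G, ∀ q ∈ N, ∀ γ ∈ Γ', q * γ ∈ T ↔ (q ∈ A ↔ γ ∈ F) := by
  classical
  refine ⟨Finset.univ.filter fun g => ∃ q γ : G, q ∈ N ∧ γ ∈ Γ' ∧ g = q * γ ∧ (q ∈ A ↔ γ ∈ F),
    fun q hq γ hγ => ?_⟩
  simp only [Finset.mem_filter, Finset.mem_univ, true_and]
  constructor
  · rintro ⟨q', γ', hq', hγ', heq, hiff⟩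
    obtain ⟨rfl, rfl⟩ := eq_of_mul_eq_mul hdisj hq hq' hγ hγ' heq
    exact hiff
  · exact fun h => ⟨q, γ, hq, hγ, rfl, h⟩

/-! ## §2 The fibre type is a CM set -/

section Fibre

omit [Fintype G] [DecidableEq G] in
/-- `T_A` is a CM set for `c`: `x ∈ T ↔ c x ∉ T` (`c (q γ) = q (c γ)`). [cite: Shimura1998, §18.2 Lemma (i)] -/
theorem fibreType_cm (hprod : ∀ g : G, ∃ q ∈ N, ∃ γ ∈ Γ', g = q * γ) (hcΓ : c ∈ Γ') (hcz : ∀ g, c * g = g * c)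
    (hFcm : ∀ v ∈ Γ', v ∈ F ↔ c * v ∉ F) (hT : ∀ q ∈ N, ∀ γ ∈ Γ', q * γ ∈ T ↔ (q ∈ A ↔ γ ∈ F)) (x : G) :
    x ∈ T ↔ c * x ∉ T := by
  obtain ⟨q, hq, γ, hγ, rfl⟩ := hprod x
  rw [← mul_assoc, hcz q, mul_assoc, hT q hq γ hγ, hT q hq (c * γ) (Γ'.mul_mem hcΓ hγ)]
  have h := hFcm γ hγ
  tauto

/-! ## §3 Periods of the fibre type -/

omit [Fintype G] [DecidableEq G] in
/-- A period `a b` (`a ∈ N`, `b ∈ Γ'`) of `T_A` with `b = 1` is a period of `A` in `N`. [folklore] -/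
theorem forall_iff_of_period_one (hcΓ : c ∈ Γ') (hFcm : ∀ v ∈ Γ', v ∈ F ↔ c * v ∉ F)
    (hT : ∀ q ∈ N, ∀ γ ∈ Γ', q * γ ∈ T ↔ (q ∈ A ↔ γ ∈ F)) {a : G} (ha : a ∈ N)
    (hper : ∀ w, w ∈ T ↔ a * w ∈ T) : ∀ q ∈ N, (q ∈ A ↔ a * q ∈ A) := by
  -- a fibre element `v₁ ∈ F`
  obtain ⟨v₁, hv₁Γ, hv₁⟩ : ∃ v₁ ∈ Γ', v₁ ∈ F := by
    by_cases h : (1 : G) ∈ F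
    · exact ⟨1, Γ'.one_mem, h⟩
    · refine ⟨c, hcΓ, ?_⟩
      by_contra h'
      exact h ((hFcm 1 Γ'.one_mem).2 (by rwa [mul_one]))
  intro q hq
  have h1 := hper (q * v₁)
  rw [← mul_assoc, hT q hq v₁ hv₁Γ, hT (a * q) (N.mul_mem ha hq) v₁ hv₁Γ] at h1
  tauto

omit [Fintype G] [DecidableEq G] in
/-- A period `a c` (`a ∈ N`) of `T_A` exchanges `A` and `N ∖ A`: `q ∈ A ↔ a q ∉ A` on `N`. [folklore] -/
theorem forall_iff_not_of_period_conj (hcΓ : c ∈ Γ') (hcz : ∀ g, c * g = g * c)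
    (hFcm : ∀ v ∈ Γ', v ∈ F ↔ c * v ∉ F) (hT : ∀ q ∈ N, ∀ γ ∈ Γ', q * γ ∈ T ↔ (q ∈ A ↔ γ ∈ F)) {a : G}
    (ha : a ∈ N) (hper : ∀ w, w ∈ T ↔ a * c * w ∈ T) : ∀ q ∈ N, (q ∈ A ↔ a * q ∉ A) := by
  obtain ⟨v₁, hv₁Γ, hv₁⟩ : ∃ v₁ ∈ Γ', v₁ ∈ F := by
    by_cases h : (1 : G) ∈ F
    · exact ⟨1, Γ'.one_mem, h⟩
    · refine ⟨c, hcΓ, ?_⟩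
      by_contra h'
      exact h ((hFcm 1 Γ'.one_mem).2 (by rwa [mul_one]))
  have hcv : c * v₁ ∉ F := (hFcm v₁ hv₁Γ).1 hv₁
  intro q hq
  have h1 := hper (q * v₁)
  rw [show a * c * (q * v₁) = a * q * (c * v₁) by rw [mul_assoc, mul_assoc, ← mul_assoc c, hcz q, mul_assoc],
    hT q hq v₁ hv₁Γ, hT (a * q) (N.mul_mem ha hq) (c * v₁) (Γ'.mul_mem hcΓ hv₁Γ)] at h1
  tauto

omit [Fintype G] [DecidableEq G] in
/-- No period `a b` (`a ∈ N`, `b ∈ Γ' ∖ {1, c}`) of `T_A` when `F` is primitive: `b` or `c b` would stabilise `F`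
(the fibre over `1`). [cite: Shimura1998, §8.2 Prop. 26] -/
theorem false_of_period (hcΓ : c ∈ Γ') (hFcm : ∀ v ∈ Γ', v ∈ F ↔ c * v ∉ F)
    (hT : ∀ q ∈ N, ∀ γ ∈ Γ', q * γ ∈ T ↔ (q ∈ A ↔ γ ∈ F)) (hcc : c * c = 1)
    (hFprim : ∀ b ∈ Γ', b ≠ 1 → ∃ v ∈ Γ', ¬ (v ∈ F ↔ b * v ∈ F))
    {a b : G} (ha : a ∈ N) (hb : b ∈ Γ') (hb1 : b ≠ 1) (hbc : b ≠ c)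
    (hper : ∀ w, w ∈ T ↔ a * b * w ∈ T) : False := by
  have hcb : c * b ≠ 1 := fun h => hbc (by rw [← one_mul b, ← hcc, mul_assoc, h, mul_one])
  have key : ∀ v ∈ Γ', ((1 : G) ∈ A ↔ v ∈ F) ↔ (a ∈ A ↔ b * v ∈ F) := fun v hv => by
    have h1 := hper (1 * v)
    rwa [hT 1 N.one_mem v hv, one_mul, mul_assoc, hT a ha (b * v) (Γ'.mul_mem hb hv)] at h1
  by_cases hs : ((1 : G) ∈ A ↔ a ∈ A)
  · obtain ⟨v, hv, hvF⟩ := hFprim b hb hb1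
    exact hvF (by have := key v hv; tauto)
  · obtain ⟨v, hv, hvF⟩ := hFprim (c * b) (Γ'.mul_mem hcΓ hb) hcb
    apply hvF
    have h1 := key v hv
    have h2 := hFcm (b * v) (Γ'.mul_mem hb hv)
    rw [← mul_assoc] at h2
    tauto

omit [Fintype G] [DecidableEq G] in
/-- **Trivial left stabiliser of `T_A`** from: `A` aperiodic in `N`, no `a ∈ N` with `aA = N ∖ A`, `F` primitive.
[cite: Shimura1998, §8.2 Prop. 26] -/
theorem fibreType_leftStabiliser (hprod : ∀ g : G, ∃ q ∈ N, ∃ γ ∈ Γ', g = q * γ) (hcΓ : c ∈ Γ')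
    (hcz : ∀ g, c * g = g * c) (hFcm : ∀ v ∈ Γ', v ∈ F ↔ c * v ∉ F)
    (hT : ∀ q ∈ N, ∀ γ ∈ Γ', q * γ ∈ T ↔ (q ∈ A ↔ γ ∈ F)) (hcc : c * c = 1)
    (hFprim : ∀ b ∈ Γ', b ≠ 1 → ∃ v ∈ Γ', ¬ (v ∈ F ↔ b * v ∈ F))
    (hAprim : ∀ a ∈ N, a ≠ 1 → ∃ q ∈ N, ¬ (q ∈ A ↔ a * q ∈ A))
    (hAcomp : ∀ a ∈ N, ∃ q ∈ N, (q ∈ A ↔ a * q ∈ A)) (y : G) (hy : y ≠ 1) :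
    ∃ w, ¬ (w ∈ T ↔ y * w ∈ T) := by
  by_contra hcon
  push Not at hcon
  obtain ⟨a, ha, b, hb, rfl⟩ := hprod y
  by_cases hb1 : b = 1
  · subst hb1
    rw [mul_one] at hcon hy
    obtain ⟨q, hq, hqA⟩ := hAprim a ha hy
    exact hqA (forall_iff_of_period_one hcΓ hFcm hT ha hcon q hq)
  by_cases hbc : b = c
  · subst hbc
    obtain ⟨q, hq, hqA⟩ := hAcomp a ha
    have := forall_iff_not_of_period_conj hcΓ hcz hFcm hT ha hcon q hq
    tauto
  · exact false_of_period hcΓ hFcm hT hcc hFprim ha hb hb1 hbc hcon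

end Fibre

/-! ## §4 The two-fibre certificate: `A` an admissible half of `N`, balanced set `N` -/

/-- **TWO-FIBRE CERTIFICATE.**  `G = N ⋊ Γ'` with `c ∈ Γ'` central, `F ⊆ Γ'` a primitive CM set, `A ⊆ N` an
admissible half (`2|A| = |N|`, aperiodic, nowhere self-complementary in `N`) ⟹ a CM set `T ⊆ G` with trivial left
stabiliser and a finite set `D` (`= N`) with `2·#{x ∈ D : x g ∈ T} = #D` for all `g` and `c D ≠ D`.
[cite: Shimura1998, §8.2 Prop. 26] [cite: Dodson1984, §3.1.1] -/
theorem exists_certificate_twoFibre [N.Normal] (hdisj : ∀ g, g ∈ N → g ∈ Γ' → g = 1)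
    (hprod : ∀ g : G, ∃ q ∈ N, ∃ γ ∈ Γ', g = q * γ) (hcΓ : c ∈ Γ') (hcz : ∀ g, c * g = g * c) (hc1 : c ≠ 1)
    (hcc : c * c = 1) (hFcm : ∀ v ∈ Γ', v ∈ F ↔ c * v ∉ F)
    (hFprim : ∀ b ∈ Γ', b ≠ 1 → ∃ v ∈ Γ', ¬ (v ∈ F ↔ b * v ∈ F)) (A : Finset G) (hAN : ∀ q ∈ A, q ∈ N)
    (hAcard : 2 * A.card = Nat.card N) (hAprim : ∀ a ∈ N, a ≠ 1 → ∃ q ∈ N, ¬ (q ∈ A ↔ a * q ∈ A))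
    (hAcomp : ∀ a ∈ N, ∃ q ∈ N, (q ∈ A ↔ a * q ∈ A)) :
    ∃ T D : Finset G, (∀ x, x ∈ T ↔ c * x ∉ T) ∧ (∀ y, y ≠ 1 → ∃ w, ¬ (w ∈ T ↔ y * w ∈ T)) ∧
      (∀ g, 2 * (D.filter fun x => x * g ∈ T).card = D.card) ∧ ∃ x ∈ D, c * x ∉ D := by
  classical
  obtain ⟨T, hT⟩ := exists_fibreType hdisj A F (N := N) (Γ' := Γ')
  set NF : Finset G := Finset.univ.filter fun g => g ∈ N with hNF_def
  have hmemN : ∀ g, g ∈ NF ↔ g ∈ N := fun g => by rw [hNF_def, Finset.mem_filter]; simp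
  have hNFc : NF.card = Nat.card N := by rw [hNF_def, Nat.card_eq_fintype_card, ← Fintype.card_subtype]
  refine ⟨T, NF, fibreType_cm hprod hcΓ hcz hFcm hT,
    fibreType_leftStabiliser hprod hcΓ hcz hFcm hT hcc hFprim hAprim hAcomp, fun g => ?_,
    ⟨1, (hmemN 1).2 N.one_mem, fun h => hc1 (hdisj c ((hmemN c).1 (by rwa [mul_one] at h)) hcΓ)⟩⟩
  obtain ⟨q, hq, γ, hγ, rfl⟩ := hprod g
  -- `x q γ ∈ T ↔ (x q ∈ A ↔ γ ∈ F)` for `x ∈ N`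
  have hAsub : A ⊆ NF := fun x hx => (hmemN x).2 (hAN x hx)
  have hcountA : (NF.filter fun x => x * q ∈ A).card = A.card := by
    refine Finset.card_bij' (fun x _ => x * q) (fun x _ => x * q⁻¹) ?_ ?_ ?_ ?_
    · intro x hx; exact (Finset.mem_filter.1 hx).2
    · intro x hx
      exact Finset.mem_filter.2 ⟨(hmemN _).2 (N.mul_mem (hAN x hx) (N.inv_mem hq)),
        by rw [inv_mul_cancel_right]; exact hx⟩
    · intro x _; exact mul_inv_cancel_right x q
    · intro x _; exact inv_mul_cancel_right x q
  rw [hNFc, ← hAcard]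
  by_cases hγF : γ ∈ F
  · rw [← hcountA]
    congr 2
    refine Finset.filter_congr fun x hx => ?_
    rw [← mul_assoc, hT (x * q) (N.mul_mem ((hmemN x).1 hx) hq) γ hγ]
    tauto
  · have h2 : (NF.filter fun x => x * (q * γ) ∈ T) = NF.filter fun x => ¬ (x * q ∈ A) := by
      refine Finset.filter_congr fun x hx => ?_
      rw [← mul_assoc, hT (x * q) (N.mul_mem ((hmemN x).1 hx) hq) γ hγ]
      tauto
    have h3 := Finset.card_filter_add_card_filter_not (s := NF) (fun x => x * q ∈ A)
    rw [hcountA, hNFc, ← hAcard] at h3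
    rw [h2]
    omega

/-! ## §5 The transversal certificate: `V ≤ N`, `3 ≤ |V|`, `y₀ ∈ N ∖ V` a non-involution; balanced set `V ∪ V y₀ c` -/

/-- **TRANSVERSAL CERTIFICATE.**  `G = N ⋊ Γ'` with `c ∈ Γ'` central, `F ⊆ Γ'` a primitive CM set, `V ≤ N` with
`3 ≤ |V|` and a non-involution `y₀ ∈ N ∖ V` ⟹ a CM set `T ⊆ G` with trivial left stabiliser (the fibre type over
gen 19's transversal `A ∋ 1` of `V` in `N`) and a finite set `D = V ∪ V y₀ c` with `2·#{x ∈ D : x g ∈ T} = #D` for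
all `g` and `c D ≠ D`. [cite: Shimura1998, §8.2 Prop. 26] [cite: Dodson1984, §3.1.1] -/
theorem exists_certificate_transversal [N.Normal] (hdisj : ∀ g, g ∈ N → g ∈ Γ' → g = 1)
    (hprod : ∀ g : G, ∃ q ∈ N, ∃ γ ∈ Γ', g = q * γ) (hcΓ : c ∈ Γ') (hcz : ∀ g, c * g = g * c) (hc1 : c ≠ 1)
    (hcc : c * c = 1) (hFcm : ∀ v ∈ Γ', v ∈ F ↔ c * v ∉ F)
    (hFprim : ∀ b ∈ Γ', b ≠ 1 → ∃ v ∈ Γ', ¬ (v ∈ F ↔ b * v ∈ F)) (V : Subgroup G) (hVN : V ≤ N)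
    (h3 : 3 ≤ Nat.card V) {y₀ : G} (hy₀N : y₀ ∈ N) (hy₀V : y₀ ∉ V) (hy₀2 : y₀ * y₀ ≠ 1) :
    ∃ T D : Finset G, (∀ x, x ∈ T ↔ c * x ∉ T) ∧ (∀ y, y ≠ 1 → ∃ w, ¬ (w ∈ T ↔ y * w ∈ T)) ∧
      (∀ g, 2 * (D.filter fun x => x * g ∈ T).card = D.card) ∧ ∃ x ∈ D, c * x ∉ D := by
  classical
  obtain ⟨A, hAN, hA1, hAT, hAstab⟩ := exists_transversal hVN h3 hy₀N hy₀V hy₀2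
  have hAcard : A.card * Nat.card V = Nat.card N := card_mul_card_eq hVN hAN hAT
  obtain ⟨T, hT⟩ := exists_fibreType hdisj A F (N := N) (Γ' := Γ')
  set NF : Finset G := Finset.univ.filter fun g => g ∈ N with hNF_def
  have hmemN : ∀ g, g ∈ NF ↔ g ∈ N := fun g => by rw [hNF_def, Finset.mem_filter]; simp
  have hNFc : NF.card = Nat.card N := by rw [hNF_def, Nat.card_eq_fintype_card, ← Fintype.card_subtype]
  set VF : Finset G := Finset.univ.filter fun g => g ∈ V with hVF_def
  have hmemV : ∀ g, g ∈ VF ↔ g ∈ V := fun g => by rw [hVF_def, Finset.mem_filter]; simp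
  have hVFc : VF.card = Nat.card V := by rw [hVF_def, Nat.card_eq_fintype_card, ← Fintype.card_subtype]
  -- aperiodic and (by cardinality) nowhere self-complementary in `N`
  have hAprim : ∀ a ∈ N, a ≠ 1 → ∃ q ∈ N, ¬ (q ∈ A ↔ a * q ∈ A) := by
    intro a _ ha1
    by_contra h
    push Not at h
    exact ha1 (hAstab a fun n hn => (h n (hAN n hn)).1 hn)
  have hAcomp : ∀ a ∈ N, ∃ q ∈ N, (q ∈ A ↔ a * q ∈ A) := by
    intro a ha
    by_contra h
    -- `q ↦ a q` maps `A` into `NF ∖ A` and `NF ∖ A` into `A`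
    have hle1 : A.card ≤ (NF \ A).card :=
      Finset.card_le_card_of_injOn (fun q => a * q)
        (fun q hq => Finset.mem_coe.2 (Finset.mem_sdiff.2 ⟨(hmemN _).2 (N.mul_mem ha (hAN q (Finset.mem_coe.1 hq))),
          fun haq => h ⟨q, hAN q (Finset.mem_coe.1 hq), fun _ => haq, fun _ => Finset.mem_coe.1 hq⟩⟩))
        (fun q _ q' _ hqq => mul_left_cancel hqq)
    have hle2 : (NF \ A).card ≤ A.card :=
      Finset.card_le_card_of_injOn (fun q => a * q)
        (fun q hq => Finset.mem_coe.2 (by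
          obtain ⟨hqN, hqA⟩ := Finset.mem_sdiff.1 (Finset.mem_coe.1 hq)
          by_contra haq
          exact h ⟨q, (hmemN q).1 hqN, fun hq' => absurd hq' hqA, fun h' => absurd h' haq⟩))
        (fun q _ q' _ hqq => mul_left_cancel hqq)
    have hsub : A ⊆ NF := fun x hx => (hmemN x).2 (hAN x hx)
    rw [Finset.card_sdiff_of_subset hsub, hNFc] at hle1 hle2
    have hApos : 0 < A.card := Finset.card_pos.2 ⟨1, hA1⟩
    have h3A : A.card * 3 ≤ A.card * Nat.card V := Nat.mul_le_mul_left _ h3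
    omega
  -- exactly one `v ∈ V` with `v y ∈ A`, for `y ∈ N`
  have hrow : ∀ y ∈ N, (VF.filter fun v => v * y ∈ A).card = 1 := by
    intro y hy
    obtain ⟨v, hv, hvy, huniq⟩ := hAT y hy
    rw [Finset.card_eq_one]
    refine ⟨v, Finset.ext fun v' => ?_⟩
    rw [Finset.mem_filter, Finset.mem_singleton, hmemV]
    exact ⟨fun h => huniq v' h.1 h.2, fun h => h ▸ ⟨hv, hvy⟩⟩
  have hrow' : ∀ y ∈ N, (VF.filter fun v => ¬ (v * y ∈ A)).card = Nat.card V - 1 := by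
    intro y hy
    have h := Finset.card_filter_add_card_filter_not (s := VF) (fun v => v * y ∈ A)
    rw [hrow y hy, hVFc] at h
    omega
  -- the balanced set `D = V ∪ V y₀ c`
  let ι : G ↪ G := ⟨fun v => v * (y₀ * c), mul_left_injective (y₀ * c)⟩
  have hdisjD : Disjoint VF (VF.map ι) := by
    rw [Finset.disjoint_left]
    intro x hx hx'
    obtain ⟨v, hv, hvx⟩ := Finset.mem_map.1 hx'
    apply hc1
    refine hdisj c ?_ hcΓ
    have : c = y₀⁻¹ * (v⁻¹ * x) := by
      rw [← hvx]; change c = y₀⁻¹ * (v⁻¹ * (v * (y₀ * c))); group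
    rw [this]
    exact N.mul_mem (N.inv_mem hy₀N) (N.mul_mem (N.inv_mem (hVN ((hmemV v).1 hv))) (hVN ((hmemV x).1 hx)))
  refine ⟨T, VF ∪ VF.map ι, fibreType_cm hprod hcΓ hcz hFcm hT,
    fibreType_leftStabiliser hprod hcΓ hcz hFcm hT hcc hFprim hAprim hAcomp, fun g => ?_,
    ⟨1, Finset.mem_union_left _ ((hmemV 1).2 V.one_mem), fun h => ?_⟩⟩
  · obtain ⟨q, hq, γ, hγ, rfl⟩ := hprod g
    rw [Finset.filter_union, Finset.card_union_of_disjoint (Finset.disjoint_filter_filter hdisjD),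
      Finset.filter_map, Finset.card_map, Finset.card_union_of_disjoint hdisjD, Finset.card_map, hVFc]
    have e1 : (VF.filter fun x => x * (q * γ) ∈ T) = VF.filter fun v => (v * q ∈ A ↔ γ ∈ F) := by
      refine Finset.filter_congr fun v hv => ?_
      rw [← mul_assoc, hT (v * q) (N.mul_mem (hVN ((hmemV v).1 hv)) hq) γ hγ]
    have e2 : VF.filter ((fun x => x * (q * γ) ∈ T) ∘ ι) = VF.filter fun v => (v * (y₀ * q) ∈ A ↔ c * γ ∈ F) := by
      refine Finset.filter_congr fun v hv => ?_
      change v * (y₀ * c) * (q * γ) ∈ T ↔ _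
      rw [show v * (y₀ * c) * (q * γ) = v * (y₀ * q) * (c * γ) by
          rw [mul_assoc, mul_assoc, mul_assoc, mul_assoc, ← mul_assoc c, hcz q, mul_assoc],
        hT (v * (y₀ * q)) (N.mul_mem (hVN ((hmemV v).1 hv)) (N.mul_mem hy₀N hq)) (c * γ) (Γ'.mul_mem hcΓ hγ)]
    rw [e1, e2]
    have hcγ : c * γ ∈ F ↔ γ ∉ F := by have := hFcm γ hγ; tauto
    by_cases hγF : γ ∈ F
    · rw [show (VF.filter fun v => (v * q ∈ A ↔ γ ∈ F)) = VF.filter fun v => v * q ∈ A from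
          Finset.filter_congr fun v _ => by tauto,
        show (VF.filter fun v => (v * (y₀ * q) ∈ A ↔ c * γ ∈ F)) = VF.filter fun v => ¬ (v * (y₀ * q) ∈ A) from
          Finset.filter_congr fun v _ => by tauto,
        hrow q hq, hrow' (y₀ * q) (N.mul_mem hy₀N hq)]
      omega
    · rw [show (VF.filter fun v => (v * q ∈ A ↔ γ ∈ F)) = VF.filter fun v => ¬ (v * q ∈ A) from
          Finset.filter_congr fun v _ => by tauto,
        show (VF.filter fun v => (v * (y₀ * q) ∈ A ↔ c * γ ∈ F)) = VF.filter fun v => v * (y₀ * q) ∈ A from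
          Finset.filter_congr fun v _ => by tauto,
        hrow' q hq, hrow (y₀ * q) (N.mul_mem hy₀N hq)]
      omega
  · rw [mul_one, Finset.mem_union] at h
    rcases h with h | h
    · exact hc1 (hdisj c (hVN ((hmemV c).1 h)) hcΓ)
    · obtain ⟨v, hv, hvc⟩ := Finset.mem_map.1 h
      apply hy₀V
      have hvy : v * y₀ = 1 := by
        have : v * (y₀ * c) = c := hvc
        rw [← mul_assoc] at this
        exact mul_right_cancel (this.trans (one_mul c).symm)
      rw [eq_inv_of_mul_eq_one_right hvy]
      exact V.inv_mem ((hmemV v).1 hv)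

end Summit.HodgeConjecture.CorCM.Complement
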